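import Summits.CriticalPhenomena.PercolationContinuityZ3.Theorems.PercNearOneGluingNoHeavyPcintDefectWordDiagram
import HarnessLib

/-!
# CriticalPhenomena/PercolationContinuityZ3 — Theorems/PercNearOneGluingNoHeavyPcintDefectWordUnique.lean: a word is compatible with AT MOST ONE one-defect structure (combinatorial core of STRUCTURE law C5-L4, part 4)

Lane prim-pcint, STRUCTURE rule «numerics ⇒ structure ⇒ conjecture» (prim-pcint-2 GEN 21); sequel of …PcintDefectWordDiagram.
If a word `w` is fully compatible (…PcintDefectWordDiagram `FCompat`) with two one-defect structures `(π, a, b)` and `(π', a', b')`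
(…PcintDefectDiagrams), then `π = π'`, `a = a'`, `b = b'` (`fcompat_unique`): off the 4-block the partner of a letter is the only other letter on
its axis (or the closing point), on the 4-block it is the only other point carrying the same letter; a letter of the 4-block of one structure has
two further letters on its axis, so it lies in the 4-block of the other; and the marked openers are the least point of the 4-block and the least
point of the other marked chord.  This is the injectivity half of the count `fullClosingCount (m−1) (2m) = (m−1)!·2^{m−1}·#defectSet` completed
in …PcintDefectWordCount.

HONEST FRAMING: elementary finite combinatorics written for the mechanism theorem of law C5-L4 (all `m`).  No `sorry`; standard axioms.
Written by prim-pcint-2 gen 21 (prover-prim-pcint-2-g21-0), 2026-08-27.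
-/

noncomputable section

namespace Summit.CriticalPhenomena.PercolationContinuityZ3.Theorems.Pcint.ChordDiag

open Literature.Probability.LatticeModels Literature.Probability.Percolation
open Summit.CriticalPhenomena.PercolationContinuityZ3.Theorems.Pcint
open Summit.CriticalPhenomena.PercolationContinuityZ3.Theorems.Pcint.MemoryTail

variable {K j : ℕ}

section Unique

variable {π π' : Fin (K + 1) → Fin (K + 1)} {a b a' b' : Fin (K + 1)} {w : Fin K → Fin j × Bool} {v v' : Fin j × Bool}

/-- The 4-block has four points. [folklore] -/
theorem card_quad (hd : IsDiag π) (h : IsPair π a b) : (quad π a b).card = 4 := by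
  obtain ⟨d1, d2, d3, d4, d5, d6⟩ := h.distinct hd
  unfold quad
  rw [Finset.card_insert_of_notMem, Finset.card_insert_of_notMem, Finset.card_pair d2]
  · simp [Ne.symm d4, d6]
  · simp [d1, d3, d5]

/-- **On the 4-block the partner is the other point with the same letter.** [folklore] -/
theorem FCompat.eq_of_letter_eq {W : Fin (K + 1) → Fin j × Bool} (hd : IsDiag π) (h : IsPair π a b) (hW : FCompat π a b W)
    {x y : Fin (K + 1)} (hx : x ∈ quad π a b) (hy : y ∈ quad π a b) (hxy : y ≠ x) (hl : W y = W x) : y = π x := by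
  obtain ⟨h1, h2, h3⟩ := hW.2.1
  have hne : W b ≠ W a := by rw [h3]; exact srev_ne_self _
  have haa := (hd a).1
  have hbb := (hd b).1
  rcases mem_quad.1 hx with rfl | rfl | rfl | rfl <;> rcases mem_quad.1 hy with rfl | rfl | rfl | rfl
  all_goals first
    | exact absurd rfl hxy
    | rfl
    | exact haa.symm
    | exact hbb.symm
    | (exfalso; apply hne; first
        | exact hl
        | exact hl.symm
        | (rw [← h1]; exact hl)
        | (rw [← h1]; exact hl.symm)
        | (rw [← h2]; exact hl)
        | (rw [← h2]; exact hl.symm)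
        | (rw [← h1, ← h2]; exact hl)
        | (rw [← h1, ← h2]; exact hl.symm))

/-- **A letter in the 4-block of one compatible structure lies in the 4-block of any other**: it has two further letters on its axis. [folklore] -/
theorem FCompat.mem_quad_of_mem_quad (hd : IsDiag π) (h : IsPair π a b) (hW : FCompat π a b (ext w v))
    (hW' : FCompat π' a' b' (ext w v')) {s : Fin K} (hx : Fin.castSucc s ∈ quad π a b) :
    Fin.castSucc s ∈ quad π' a' b' := by
  classical
  by_contra hx'
  -- two further real points of the 4-block
  set S := ((quad π a b).erase (Fin.castSucc s)).erase (Fin.last K) with hS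
  have hcard : 1 < S.card := by
    have h4 := card_quad hd h
    have h3 : ((quad π a b).erase (Fin.castSucc s)).card = 3 := by rw [Finset.card_erase_of_mem hx, h4]
    have := Finset.card_erase_le (s := (quad π a b).erase (Fin.castSucc s)) (a := Fin.last K)
    have h2 : 2 ≤ S.card := by
      rw [hS]
      by_cases hl : Fin.last K ∈ (quad π a b).erase (Fin.castSucc s)
      · rw [Finset.card_erase_of_mem hl, h3]
      · rw [Finset.erase_eq_of_notMem hl, h3]; norm_num
    omega
  obtain ⟨y₁, hy₁, y₂, hy₂, hne⟩ := Finset.one_lt_card.1 hcard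
  have key : ∀ y ∈ S, π' (Fin.castSucc s) = y := by
    intro y hy
    rw [hS, Finset.mem_erase, Finset.mem_erase] at hy
    obtain ⟨hyl, hys, hyq⟩ := hy
    obtain ⟨t, rfl⟩ := Fin.exists_castSucc_eq.2 hyl
    have hax : (ext w v' (Fin.castSucc s)).1 = (ext w v' (Fin.castSucc t)).1 := by
      rw [ext_castSucc, ext_castSucc, ← ext_castSucc w v s, ← ext_castSucc w v t, fst_eq_of_mem_quad hW hx,
        fst_eq_of_mem_quad hW hyq]
    rcases hW'.2.2 _ _ (Ne.symm hys) hax with h1 | h1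
    · exact h1
    · exact absurd h1.1 hx'
  exact hne ((key y₁ hy₁).symm.trans (key y₂ hy₂))

/-- The closing point lies in the 4-block of one compatible structure iff in that of any other. [folklore] -/
theorem FCompat.last_mem_quad_iff (hd : IsDiag π) (h : IsPair π a b) (hW : FCompat π a b (ext w v))
    (hd' : IsDiag π') (h' : IsPair π' a' b') (hW' : FCompat π' a' b' (ext w v'))
    (hreal : ∀ s : Fin K, π (Fin.castSucc s) = π' (Fin.castSucc s)) :
    Fin.last K ∈ quad π a b ↔ Fin.last K ∈ quad π' a' b' := by
  -- the partner of the closing point is a real letter, the same for both structures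
  obtain ⟨l, hl⟩ := Fin.exists_castSucc_eq.2 (hd (Fin.last K)).2
  have hpl : π (Fin.castSucc l) = Fin.last K := by rw [hl, (hd _).1]
  have hpl' : π' (Fin.castSucc l) = Fin.last K := by rw [← hreal l, hpl]
  constructor
  · intro hq
    have h1 : Fin.castSucc l ∈ quad π a b := by rw [← mem_quad_apply hd, hpl]; exact hq
    have h2 := hW.mem_quad_of_mem_quad hd h hW' h1
    rw [← hpl', mem_quad_apply hd']; exact h2
  · intro hq
    have h1 : Fin.castSucc l ∈ quad π' a' b' := by rw [← mem_quad_apply hd', hpl']; exact hq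
    have h2 := hW'.mem_quad_of_mem_quad hd' h' hW h1
    rw [← hpl, mem_quad_apply hd]; exact h2

/-- The least point of the 4-block is the first marked opener. [folklore] -/
theorem IsPair.le_of_mem_quad (h : IsPair π a b) {x : Fin (K + 1)} (hx : x ∈ quad π a b) : a ≤ x := by
  obtain ⟨h1, h2, h3, -⟩ := h
  rcases mem_quad.1 hx with rfl | rfl | rfl | rfl
  · exact le_rfl
  · exact h1.le
  · exact h3.le
  · exact (h3.trans h2).le

/-- **Uniqueness of the compatible structure.** [folklore] -/
theorem fcompat_unique (hd : IsDiag π) (h : IsPair π a b) (hW : FCompat π a b (ext w v))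
    (hd' : IsDiag π') (h' : IsPair π' a' b') (hW' : FCompat π' a' b' (ext w v')) : π = π' ∧ a = a' ∧ b = b' := by
  -- Step 1: the two diagrams agree on the real letters
  have hreal : ∀ s : Fin K, π (Fin.castSucc s) = π' (Fin.castSucc s) := by
    -- symmetric core: the partner of a real letter, if real, is the same for the other structure
    have core : ∀ {π π' : Fin (K + 1) → Fin (K + 1)} {a b a' b' : Fin (K + 1)} {v v' : Fin j × Bool},
        IsDiag π → IsPair π a b → FCompat π a b (ext w v) → IsDiag π' → IsPair π' a' b' → FCompat π' a' b' (ext w v') →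
        ∀ s t : Fin K, π (Fin.castSucc s) = Fin.castSucc t → π' (Fin.castSucc s) = Fin.castSucc t := by
      intro π π' a b a' b' v v' hd h hW hd' h' hW' s t hst
      have hts : Fin.castSucc t ≠ Fin.castSucc s := fun e => (hd _).2 (hst.trans e)
      by_cases hx : Fin.castSucc s ∈ quad π a b
      · -- on the 4-block: the partner carries the same letter
        have hx' := hW.mem_quad_of_mem_quad hd h hW' hx
        have htq : Fin.castSucc t ∈ quad π a b := by rw [← hst, mem_quad_apply hd]; exact hx
        have htq' := hW.mem_quad_of_mem_quad hd h hW' htq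
        have hl : ext w v (Fin.castSucc t) = ext w v (Fin.castSucc s) := by
          -- `π x` carries the letter of `x` on the 4-block
          obtain ⟨h1, h2, h3⟩ := hW.2.1
          rw [← hst]
          rcases mem_quad.1 hx with e | e | e | e <;> rw [e]
          · exact h1
          · rw [(hd a).1, h1]
          · exact h2
          · rw [(hd b).1, h2]
        have hl' : ext w v' (Fin.castSucc t) = ext w v' (Fin.castSucc s) := by
          rw [ext_castSucc, ext_castSucc]; rw [ext_castSucc, ext_castSucc] at hl; exact hl
        exact (hW'.eq_of_letter_eq hd' h' hx' htq' hts hl').symm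
      · -- off the 4-block: the partner is the other letter on the axis
        have hx' : Fin.castSucc s ∉ quad π' a' b' := fun e => hx (hW'.mem_quad_of_mem_quad hd' h' hW e)
        have hax : (ext w v' (Fin.castSucc s)).1 = (ext w v' (Fin.castSucc t)).1 := by
          have := congrArg Prod.fst (hW.1 _ hx)
          rw [hst, ext_castSucc, ext_castSucc] at this
          rw [ext_castSucc, ext_castSucc, this]; rfl
        rcases hW'.2.2 _ _ (Ne.symm hts) hax with e | e
        · exact e
        · exact absurd e.1 hx'
    intro s
    rcases Fin.eq_castSucc_or_eq_last (π (Fin.castSucc s)) with ⟨t, ht⟩ | hl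
    · rw [ht, core hd h hW hd' h' hW' s t ht]
    · rcases Fin.eq_castSucc_or_eq_last (π' (Fin.castSucc s)) with ⟨t', ht'⟩ | hl'
      · have := core hd' h' hW' hd h hW s t' ht'
        rw [hl] at this
        exact absurd this.symm (Fin.castSucc_lt_last t').ne
      · rw [hl, hl']
  -- Step 2: hence everywhere
  have hπ : π = π' := by
    funext x
    induction x using Fin.lastCases with
    | cast s => exact hreal s
    | last =>
      obtain ⟨l, hl⟩ := Fin.exists_castSucc_eq.2 (hd (Fin.last K)).2
      have h1 : π (Fin.castSucc l) = Fin.last K := by rw [hl, (hd _).1]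
      rw [hreal l] at h1
      rw [← hl, ← h1, (hd' _).1]
  -- Step 3: the 4-blocks coincide
  have hQ : quad π a b = quad π' a' b' := by
    have hlast := hW.last_mem_quad_iff hd h hd' h' hW' hreal
    ext x
    induction x using Fin.lastCases with
    | last => exact hlast
    | cast s => exact ⟨fun e => hW.mem_quad_of_mem_quad hd h hW' e, fun e => hW'.mem_quad_of_mem_quad hd' h' hW e⟩
  -- Step 4: the openers are determined by the 4-block and the diagram
  have ha : a = a' := by
    have h1 : a ≤ a' := h.le_of_mem_quad (by rw [hQ, mem_quad]; exact Or.inl rfl)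
    have h2 : a' ≤ a := h'.le_of_mem_quad (by rw [← hQ, mem_quad]; exact Or.inl rfl)
    exact le_antisymm h1 h2
  subst hπ; subst ha
  refine ⟨rfl, rfl, ?_⟩
  obtain ⟨d1, d2, d3, d4, d5, d6⟩ := h.distinct hd
  obtain ⟨d1', d2', d3', d4', d5', d6'⟩ := h'.distinct hd
  have hb' : b' ∈ quad π a b := by rw [hQ, mem_quad]; exact Or.inr (Or.inr (Or.inl rfl))
  have hb : b ∈ quad π a b' := by rw [← hQ, mem_quad]; exact Or.inr (Or.inr (Or.inl rfl))
  rcases mem_quad.1 hb' with e | e | e | e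
  · exact absurd e.symm d3'
  · exact absurd e d4'
  · exact e.symm
  · -- `b' = π b` and symmetrically `b = π b'`: contradiction with the orientations
    rcases mem_quad.1 hb with e' | e' | e' | e'
    · exact absurd e'.symm d3
    · exact absurd e' d4
    · exact e'
    · exfalso
      have := h.2.1
      rw [← e, e'] at this
      exact lt_asymm this h'.2.1

end Unique

end Summit.CriticalPhenomena.PercolationContinuityZ3.Theorems.Pcint.ChordDiag
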